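import Mathlib
import Summits.Ventures.PercRepro2.FiveTypedBridge

/-!
# Five typed edges: the alone-end reduction, I (blind cell PercRepro2, night-3, 2026-08-24)
`nonneg_of_alone5a`: an end among the points `5` … `9` alone in its class of the closed
configuration makes its edge inert; the count is nonnegative by the four-edge theorem.
-/

namespace Summit.Ventures.PercRepro2

open UnionCluster

namespace CovForm

namespace TwoTyped

open OneTyped TypedRed

section Alone5

open Classical

variable {V : Type*} {E : Type*} [Fintype E] [DecidableEq E] {R : Type*} [Field R]
  [LinearOrder R] [IsStrictOrderedRing R]
variable (ends : E → Sym2 V) (o a₁ a₂ a₃ b : V)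

set_option maxHeartbeats 4000000 in
/-- Alone ends at the points `5` … `9`: the count is nonnegative. -/
lemma nonneg_of_alone5a (hall4 : allOk4 = true) (e₁ e₂ e₃ e₄ e₅ : E) (z : Config E) (τ : E → ℕ)
    (hτ : ∀ e ∈ ({e₁, e₂, e₃, e₄, e₅} : Finset E), τ e = 1 ∨ τ e = 2) (z0 : Config E)
    (hz0c : closedOn ({e₁, e₂, e₃, e₄, e₅} : Finset E) z = z0) (ps : Fin 5 → V × V)
    (hends₁ : ends e₁ = s((ps 0).1, (ps 0).2))
    (hends₂ : ends e₂ = s((ps 1).1, (ps 1).2))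
    (hends₃ : ends e₃ = s((ps 2).1, (ps 2).2))
    (hends₄ : ends e₄ = s((ps 3).1, (ps 3).2))
    (hends₅ : ends e₅ = s((ps 4).1, (ps 4).2))
    (hA : let f := lab ends o a₁ a₂ a₃ b (xsOf5 ps) z0
      (f 5 = 5 ∧ ¬f 6 = 5 ∧ ¬f 7 = 5 ∧ ¬f 8 = 5 ∧ ¬f 9 = 5 ∧ ¬f 10 = 5 ∧ ¬f 11 = 5 ∧ ¬f 12 = 5 ∧ ¬f 13 = 5 ∧ ¬f 14 = 5) ∨
      (f 6 = 6 ∧ ¬f 7 = 6 ∧ ¬f 8 = 6 ∧ ¬f 9 = 6 ∧ ¬f 10 = 6 ∧ ¬f 11 = 6 ∧ ¬f 12 = 6 ∧ ¬f 13 = 6 ∧ ¬f 14 = 6) ∨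
      (f 7 = 7 ∧ ¬f 8 = 7 ∧ ¬f 9 = 7 ∧ ¬f 10 = 7 ∧ ¬f 11 = 7 ∧ ¬f 12 = 7 ∧ ¬f 13 = 7 ∧ ¬f 14 = 7) ∨
      (f 8 = 8 ∧ ¬f 9 = 8 ∧ ¬f 10 = 8 ∧ ¬f 11 = 8 ∧ ¬f 12 = 8 ∧ ¬f 13 = 8 ∧ ¬f 14 = 8) ∨
      (f 9 = 9 ∧ ¬f 10 = 9 ∧ ¬f 11 = 9 ∧ ¬f 12 = 9 ∧ ¬f 13 = 9 ∧ ¬f 14 = 9)) :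
    0 ≤ typedCount {e₁, e₂, e₃, e₄, e₅} z τ (K3 ends o a₁ a₂ a₃ b : Config E → Config E → Config E → R) := by
  set f := lab ends o a₁ a₂ a₃ b (xsOf5 ps) z0 with hfdef
  have hf : ∀ p q, f p = f q ↔ Conn ends z0 (pt o a₁ a₂ a₃ b (xsOf5 ps) p) (pt o a₁ a₂ a₃ b (xsOf5 ps) q) :=
    fun p q => lab_eq_iff ends o a₁ a₂ a₃ b (xsOf5 ps) z0 p q
  have hle : ∀ i, f i ≤ i := lab_le ends o a₁ a₂ a₃ b (xsOf5 ps) z0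
  simp only [] at hA
  rcases hA with h | h | h | h | h
  · obtain ⟨ea5_5, ea5_6, ea5_7, ea5_8, ea5_9, ea5_10, ea5_11, ea5_12, ea5_13, ea5_14⟩ := h
    have hp : ∀ q, q ≤ 14 → q ≠ 5 → f q ≠ f 5 := by
      intro q hq hqp
      have hl0 := hle 0
      have hl1 := hle 1
      have hl2 := hle 2
      have hl3 := hle 3
      have hl4 := hle 4
      have hl5 := hle 5
      have hl6 := hle 6
      have hl7 := hle 7
      have hl8 := hle 8
      have hl9 := hle 9
      have hl10 := hle 10
      have hl11 := hle 11
      have hl12 := hle 12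
      have hl13 := hle 13
      have hl14 := hle 14
      interval_cases q <;> omega
    refine nonneg_of_inert5 ends o a₁ a₂ a₃ b hall4 {e₁, e₂, e₃, e₄, e₅} e₁ (by simp) (Finset.card_le_five) hτ ?_
    refine typedCount_inert_of_alone ends o a₁ a₂ a₃ b {e₁, e₂, e₃, e₄, e₅} e₁ (by simp) hends₁ z τ ?_ ?_
    · rw [hz0c]
      rintro m (rfl | rfl | rfl | rfl | rfl) hc
      · exact hp 2 (by norm_num) (by norm_num) ((hf 2 5).mpr (conn_symm hc))
      · exact hp 0 (by norm_num) (by norm_num) ((hf 0 5).mpr (conn_symm hc))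
      · exact hp 1 (by norm_num) (by norm_num) ((hf 1 5).mpr (conn_symm hc))
      · exact hp 4 (by norm_num) (by norm_num) ((hf 4 5).mpr (conn_symm hc))
      · exact hp 3 (by norm_num) (by norm_num) ((hf 3 5).mpr (conn_symm hc))
    · rw [hz0c]
      intro f' hf' hne y hy hc
      simp only [Finset.mem_insert, Finset.mem_singleton] at hf'
      rcases hf' with rfl | rfl | rfl | rfl | rfl
      · exact absurd rfl hne
      · rw [hends₂] at hy
        rcases Sym2.mem_iff.mp hy with rfl | rfl
        · exact hp 7 (by norm_num) (by norm_num) ((hf 7 5).mpr (conn_symm hc))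
        · exact hp 8 (by norm_num) (by norm_num) ((hf 8 5).mpr (conn_symm hc))
      · rw [hends₃] at hy
        rcases Sym2.mem_iff.mp hy with rfl | rfl
        · exact hp 9 (by norm_num) (by norm_num) ((hf 9 5).mpr (conn_symm hc))
        · exact hp 10 (by norm_num) (by norm_num) ((hf 10 5).mpr (conn_symm hc))
      · rw [hends₄] at hy
        rcases Sym2.mem_iff.mp hy with rfl | rfl
        · exact hp 11 (by norm_num) (by norm_num) ((hf 11 5).mpr (conn_symm hc))
        · exact hp 12 (by norm_num) (by norm_num) ((hf 12 5).mpr (conn_symm hc))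
      · rw [hends₅] at hy
        rcases Sym2.mem_iff.mp hy with rfl | rfl
        · exact hp 13 (by norm_num) (by norm_num) ((hf 13 5).mpr (conn_symm hc))
        · exact hp 14 (by norm_num) (by norm_num) ((hf 14 5).mpr (conn_symm hc))
  · obtain ⟨ea6_6, ea6_7, ea6_8, ea6_9, ea6_10, ea6_11, ea6_12, ea6_13, ea6_14⟩ := h
    have hp : ∀ q, q ≤ 14 → q ≠ 6 → f q ≠ f 6 := by
      intro q hq hqp
      have hl0 := hle 0
      have hl1 := hle 1
      have hl2 := hle 2
      have hl3 := hle 3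
      have hl4 := hle 4
      have hl5 := hle 5
      have hl6 := hle 6
      have hl7 := hle 7
      have hl8 := hle 8
      have hl9 := hle 9
      have hl10 := hle 10
      have hl11 := hle 11
      have hl12 := hle 12
      have hl13 := hle 13
      have hl14 := hle 14
      interval_cases q <;> omega
    refine nonneg_of_inert5 ends o a₁ a₂ a₃ b hall4 {e₁, e₂, e₃, e₄, e₅} e₁ (by simp) (Finset.card_le_five) hτ ?_
    refine typedCount_inert_of_alone ends o a₁ a₂ a₃ b {e₁, e₂, e₃, e₄, e₅} e₁ (by simp) (show ends e₁ = s((ps 0).2, (ps 0).1) by rw [hends₁, Sym2.eq_swap]) z τ ?_ ?_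
    · rw [hz0c]
      rintro m (rfl | rfl | rfl | rfl | rfl) hc
      · exact hp 2 (by norm_num) (by norm_num) ((hf 2 6).mpr (conn_symm hc))
      · exact hp 0 (by norm_num) (by norm_num) ((hf 0 6).mpr (conn_symm hc))
      · exact hp 1 (by norm_num) (by norm_num) ((hf 1 6).mpr (conn_symm hc))
      · exact hp 4 (by norm_num) (by norm_num) ((hf 4 6).mpr (conn_symm hc))
      · exact hp 3 (by norm_num) (by norm_num) ((hf 3 6).mpr (conn_symm hc))
    · rw [hz0c]
      intro f' hf' hne y hy hc
      simp only [Finset.mem_insert, Finset.mem_singleton] at hf'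
      rcases hf' with rfl | rfl | rfl | rfl | rfl
      · exact absurd rfl hne
      · rw [hends₂] at hy
        rcases Sym2.mem_iff.mp hy with rfl | rfl
        · exact hp 7 (by norm_num) (by norm_num) ((hf 7 6).mpr (conn_symm hc))
        · exact hp 8 (by norm_num) (by norm_num) ((hf 8 6).mpr (conn_symm hc))
      · rw [hends₃] at hy
        rcases Sym2.mem_iff.mp hy with rfl | rfl
        · exact hp 9 (by norm_num) (by norm_num) ((hf 9 6).mpr (conn_symm hc))
        · exact hp 10 (by norm_num) (by norm_num) ((hf 10 6).mpr (conn_symm hc))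
      · rw [hends₄] at hy
        rcases Sym2.mem_iff.mp hy with rfl | rfl
        · exact hp 11 (by norm_num) (by norm_num) ((hf 11 6).mpr (conn_symm hc))
        · exact hp 12 (by norm_num) (by norm_num) ((hf 12 6).mpr (conn_symm hc))
      · rw [hends₅] at hy
        rcases Sym2.mem_iff.mp hy with rfl | rfl
        · exact hp 13 (by norm_num) (by norm_num) ((hf 13 6).mpr (conn_symm hc))
        · exact hp 14 (by norm_num) (by norm_num) ((hf 14 6).mpr (conn_symm hc))
  · obtain ⟨ea7_7, ea7_8, ea7_9, ea7_10, ea7_11, ea7_12, ea7_13, ea7_14⟩ := h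
    have hp : ∀ q, q ≤ 14 → q ≠ 7 → f q ≠ f 7 := by
      intro q hq hqp
      have hl0 := hle 0
      have hl1 := hle 1
      have hl2 := hle 2
      have hl3 := hle 3
      have hl4 := hle 4
      have hl5 := hle 5
      have hl6 := hle 6
      have hl7 := hle 7
      have hl8 := hle 8
      have hl9 := hle 9
      have hl10 := hle 10
      have hl11 := hle 11
      have hl12 := hle 12
      have hl13 := hle 13
      have hl14 := hle 14
      interval_cases q <;> omega
    refine nonneg_of_inert5 ends o a₁ a₂ a₃ b hall4 {e₁, e₂, e₃, e₄, e₅} e₂ (by simp) (Finset.card_le_five) hτ ?_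
    refine typedCount_inert_of_alone ends o a₁ a₂ a₃ b {e₁, e₂, e₃, e₄, e₅} e₂ (by simp) hends₂ z τ ?_ ?_
    · rw [hz0c]
      rintro m (rfl | rfl | rfl | rfl | rfl) hc
      · exact hp 2 (by norm_num) (by norm_num) ((hf 2 7).mpr (conn_symm hc))
      · exact hp 0 (by norm_num) (by norm_num) ((hf 0 7).mpr (conn_symm hc))
      · exact hp 1 (by norm_num) (by norm_num) ((hf 1 7).mpr (conn_symm hc))
      · exact hp 4 (by norm_num) (by norm_num) ((hf 4 7).mpr (conn_symm hc))
      · exact hp 3 (by norm_num) (by norm_num) ((hf 3 7).mpr (conn_symm hc))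
    · rw [hz0c]
      intro f' hf' hne y hy hc
      simp only [Finset.mem_insert, Finset.mem_singleton] at hf'
      rcases hf' with rfl | rfl | rfl | rfl | rfl
      · rw [hends₁] at hy
        rcases Sym2.mem_iff.mp hy with rfl | rfl
        · exact hp 5 (by norm_num) (by norm_num) ((hf 5 7).mpr (conn_symm hc))
        · exact hp 6 (by norm_num) (by norm_num) ((hf 6 7).mpr (conn_symm hc))
      · exact absurd rfl hne
      · rw [hends₃] at hy
        rcases Sym2.mem_iff.mp hy with rfl | rfl
        · exact hp 9 (by norm_num) (by norm_num) ((hf 9 7).mpr (conn_symm hc))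
        · exact hp 10 (by norm_num) (by norm_num) ((hf 10 7).mpr (conn_symm hc))
      · rw [hends₄] at hy
        rcases Sym2.mem_iff.mp hy with rfl | rfl
        · exact hp 11 (by norm_num) (by norm_num) ((hf 11 7).mpr (conn_symm hc))
        · exact hp 12 (by norm_num) (by norm_num) ((hf 12 7).mpr (conn_symm hc))
      · rw [hends₅] at hy
        rcases Sym2.mem_iff.mp hy with rfl | rfl
        · exact hp 13 (by norm_num) (by norm_num) ((hf 13 7).mpr (conn_symm hc))
        · exact hp 14 (by norm_num) (by norm_num) ((hf 14 7).mpr (conn_symm hc))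
  · obtain ⟨ea8_8, ea8_9, ea8_10, ea8_11, ea8_12, ea8_13, ea8_14⟩ := h
    have hp : ∀ q, q ≤ 14 → q ≠ 8 → f q ≠ f 8 := by
      intro q hq hqp
      have hl0 := hle 0
      have hl1 := hle 1
      have hl2 := hle 2
      have hl3 := hle 3
      have hl4 := hle 4
      have hl5 := hle 5
      have hl6 := hle 6
      have hl7 := hle 7
      have hl8 := hle 8
      have hl9 := hle 9
      have hl10 := hle 10
      have hl11 := hle 11
      have hl12 := hle 12
      have hl13 := hle 13
      have hl14 := hle 14
      interval_cases q <;> omega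
    refine nonneg_of_inert5 ends o a₁ a₂ a₃ b hall4 {e₁, e₂, e₃, e₄, e₅} e₂ (by simp) (Finset.card_le_five) hτ ?_
    refine typedCount_inert_of_alone ends o a₁ a₂ a₃ b {e₁, e₂, e₃, e₄, e₅} e₂ (by simp) (show ends e₂ = s((ps 1).2, (ps 1).1) by rw [hends₂, Sym2.eq_swap]) z τ ?_ ?_
    · rw [hz0c]
      rintro m (rfl | rfl | rfl | rfl | rfl) hc
      · exact hp 2 (by norm_num) (by norm_num) ((hf 2 8).mpr (conn_symm hc))
      · exact hp 0 (by norm_num) (by norm_num) ((hf 0 8).mpr (conn_symm hc))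
      · exact hp 1 (by norm_num) (by norm_num) ((hf 1 8).mpr (conn_symm hc))
      · exact hp 4 (by norm_num) (by norm_num) ((hf 4 8).mpr (conn_symm hc))
      · exact hp 3 (by norm_num) (by norm_num) ((hf 3 8).mpr (conn_symm hc))
    · rw [hz0c]
      intro f' hf' hne y hy hc
      simp only [Finset.mem_insert, Finset.mem_singleton] at hf'
      rcases hf' with rfl | rfl | rfl | rfl | rfl
      · rw [hends₁] at hy
        rcases Sym2.mem_iff.mp hy with rfl | rfl
        · exact hp 5 (by norm_num) (by norm_num) ((hf 5 8).mpr (conn_symm hc))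
        · exact hp 6 (by norm_num) (by norm_num) ((hf 6 8).mpr (conn_symm hc))
      · exact absurd rfl hne
      · rw [hends₃] at hy
        rcases Sym2.mem_iff.mp hy with rfl | rfl
        · exact hp 9 (by norm_num) (by norm_num) ((hf 9 8).mpr (conn_symm hc))
        · exact hp 10 (by norm_num) (by norm_num) ((hf 10 8).mpr (conn_symm hc))
      · rw [hends₄] at hy
        rcases Sym2.mem_iff.mp hy with rfl | rfl
        · exact hp 11 (by norm_num) (by norm_num) ((hf 11 8).mpr (conn_symm hc))
        · exact hp 12 (by norm_num) (by norm_num) ((hf 12 8).mpr (conn_symm hc))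
      · rw [hends₅] at hy
        rcases Sym2.mem_iff.mp hy with rfl | rfl
        · exact hp 13 (by norm_num) (by norm_num) ((hf 13 8).mpr (conn_symm hc))
        · exact hp 14 (by norm_num) (by norm_num) ((hf 14 8).mpr (conn_symm hc))
  · obtain ⟨ea9_9, ea9_10, ea9_11, ea9_12, ea9_13, ea9_14⟩ := h
    have hp : ∀ q, q ≤ 14 → q ≠ 9 → f q ≠ f 9 := by
      intro q hq hqp
      have hl0 := hle 0
      have hl1 := hle 1
      have hl2 := hle 2
      have hl3 := hle 3
      have hl4 := hle 4
      have hl5 := hle 5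
      have hl6 := hle 6
      have hl7 := hle 7
      have hl8 := hle 8
      have hl9 := hle 9
      have hl10 := hle 10
      have hl11 := hle 11
      have hl12 := hle 12
      have hl13 := hle 13
      have hl14 := hle 14
      interval_cases q <;> omega
    refine nonneg_of_inert5 ends o a₁ a₂ a₃ b hall4 {e₁, e₂, e₃, e₄, e₅} e₃ (by simp) (Finset.card_le_five) hτ ?_
    refine typedCount_inert_of_alone ends o a₁ a₂ a₃ b {e₁, e₂, e₃, e₄, e₅} e₃ (by simp) hends₃ z τ ?_ ?_
    · rw [hz0c]
      rintro m (rfl | rfl | rfl | rfl | rfl) hc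
      · exact hp 2 (by norm_num) (by norm_num) ((hf 2 9).mpr (conn_symm hc))
      · exact hp 0 (by norm_num) (by norm_num) ((hf 0 9).mpr (conn_symm hc))
      · exact hp 1 (by norm_num) (by norm_num) ((hf 1 9).mpr (conn_symm hc))
      · exact hp 4 (by norm_num) (by norm_num) ((hf 4 9).mpr (conn_symm hc))
      · exact hp 3 (by norm_num) (by norm_num) ((hf 3 9).mpr (conn_symm hc))
    · rw [hz0c]
      intro f' hf' hne y hy hc
      simp only [Finset.mem_insert, Finset.mem_singleton] at hf'
      rcases hf' with rfl | rfl | rfl | rfl | rfl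
      · rw [hends₁] at hy
        rcases Sym2.mem_iff.mp hy with rfl | rfl
        · exact hp 5 (by norm_num) (by norm_num) ((hf 5 9).mpr (conn_symm hc))
        · exact hp 6 (by norm_num) (by norm_num) ((hf 6 9).mpr (conn_symm hc))
      · rw [hends₂] at hy
        rcases Sym2.mem_iff.mp hy with rfl | rfl
        · exact hp 7 (by norm_num) (by norm_num) ((hf 7 9).mpr (conn_symm hc))
        · exact hp 8 (by norm_num) (by norm_num) ((hf 8 9).mpr (conn_symm hc))
      · exact absurd rfl hne
      · rw [hends₄] at hy
        rcases Sym2.mem_iff.mp hy with rfl | rfl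
        · exact hp 11 (by norm_num) (by norm_num) ((hf 11 9).mpr (conn_symm hc))
        · exact hp 12 (by norm_num) (by norm_num) ((hf 12 9).mpr (conn_symm hc))
      · rw [hends₅] at hy
        rcases Sym2.mem_iff.mp hy with rfl | rfl
        · exact hp 13 (by norm_num) (by norm_num) ((hf 13 9).mpr (conn_symm hc))
        · exact hp 14 (by norm_num) (by norm_num) ((hf 14 9).mpr (conn_symm hc))

end Alone5

end TwoTyped

end CovForm

end Summit.Ventures.PercRepro2
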